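import Summits.QuantumFields.YangMills.Theorems.UnitScaleTiltFluctuationComparisonRegPrPrintChiEdgeVacuous
import Literature.MathematicalPhysics.QuantumFieldTheory.Balaban1983to89.T3ThresholdSmallness
import HarnessLib

/-!
# `UnitScaleTiltFluctuationComparisonRegPrPrintChiEdgeAt` — STUB 4′ of crux `FluctuationComparisonRegPrL` (stmt-QuantumFields-19935), (R1) «print's χ back», part 11:
# THE EDGE STUB (ii)* AT ONE BLOCK SIZE BELOW THE FLOOR, IN THE SANCTIONED QUANTIFIER SHAPE — from [Balaban1985Variational] Thm 1 with a minimiser gain `B₃` satisfying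
# `2B₃ < L√L` and from frequent positivity of both restricted densities on the window (STUB 1's currency); thresholds by `T3ThresholdSmallness.exists_forall_θBal_le`

Cell `ym3-torus`, width-lever lane `ym-ust-19935-r1`; parts 1–10 landed (… p534852).  Count-neutral helper (`--supports stmt-QuantumFields-19935`).  Pure bookkeeping; no numerics;
nothing of [Balaban1985UV3]/[King1986] is asserted.

* `edgeOffChiAt_of_thm1GlobalMinAt` — for ONE odd block size `L`: if [7] Thm 1 holds in the global reading with constants `a₀, a₁, B₃ > 0`, `2B₃ < L√L` (the structural floor of part 9
  with room for a margin), and below some coupling threshold both runs' restricted height densities are positive on a NON-NULL part of every comparison window, then the text of (ii)*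
  AT THIS `L` holds: `∃ μ ∈ (0,1), ∃ b₁ p₁, ∀ (b₀,p₀) ⪰ …, ∃ ε₁, ∀ ε₀ ≤ ε₁, ∃ m₀, ∀ m ≥ m₀, ∃ γ₁, ∀ F γ …, ⟨(ii)-body at μ⟩` — witnesses `μ = (1 − 2B₃/(L√L))/2`, `b₁ = p₁ = 0`,
  `ε₁ = a₀`, `m₀ = 2`, `γ₁ = min(γ_θ(ε₀), γ_pos, 1)`; part 10's `edgeOffChi_of_thm1GlobalMinAt` per family.
LOCATED READING: with [7]'s gain `B₃ ≈ 4–4.3` the hypothesis `2B₃ < L√L` holds at `L = 5` (11.18) and fails at `L = 3` (5.20): the registered 4′ at `L = 5` is then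
«2′ ∧ (i)*(5)» modulo [7] and positivity (via `fourPrime_of_slackOnChi_edge` restricted to L = 5 by a future cut), while `L = 3` keeps a genuine edge clause (FINDING #44).

References: T. Bałaban, CMP 102 (1985) 277–309 [Balaban1985Variational] (Thm 1 (8) p.279); C. King, CMP 102 (1986) 649–677 [King1986] (Prop. 3.8–3.9 pp.664–665).
-/

noncomputable section

namespace Summit.QuantumFields.YangMills.Theorems.PrintChi

open MeasureTheory Filter
open Literature.MathematicalPhysics.QuantumFieldTheory.Balaban1983to89
open Literature.MathematicalPhysics.QuantumFieldTheory.Balaban1983to89.T3ContinuumYM3Torus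
open Literature.MathematicalPhysics.QuantumFieldTheory.Balaban1983to89.T3UnitLawDensityEML (ℰp measurableE_ℰp)
open Literature.MathematicalPhysics.QuantumFieldTheory.Balaban1983to89.T3UnitScaleTilt
open Literature.MathematicalPhysics.QuantumFieldTheory.Balaban1983to89.T3TiltDescent
open Literature.MathematicalPhysics.QuantumFieldTheory.Balaban1983to89.T3PrintedRegularMinimiser
open Literature.MathematicalPhysics.QuantumFieldTheory.Balaban1983to89.T3PrintedMinimiserExistence
open Literature.MathematicalPhysics.QuantumFieldTheory.Balaban1983to89.T3ThresholdSmallness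
open Literature.MathematicalPhysics.QuantumFieldTheory.Balaban1983to89.ExpMeanLog (deltaSU deltaSU_pos)

/-- **THE EDGE STUB (ii)* AT ONE BLOCK SIZE BELOW THE FLOOR.**  For an odd block size `L > 1` at which [Balaban1985Variational] Thm 1 holds in the global reading with a minimiser gain
`B₃` satisfying `2B₃ < L√L`, and at which both runs' `histGood`-restricted height densities are positive on a non-null part of every comparison window below a coupling threshold
(STUB 1's currency, weakened from «a.e.» to «frequently»), the (ii)*-text of RULING g21-№4 holds AT THIS `L`: margin `μ = (1 − 2B₃/(L√L))/2`, thresholds `b₁ = p₁ = 0`, `ε₁ = a₀`,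
`m₀ = 2`, `γ₁` from `exists_forall_θBal_le` at the target `min(a₁, ε₀/B₃, ε₀/5, 1/(3C₀B₃), c′₂/(2B₃))` and the positivity threshold — then part 10's `edgeOffChi_of_thm1GlobalMinAt`.
[cite: Balaban1985Variational, Thm 1 (8) p.279] -/
theorem edgeOffChiAt_of_thm1GlobalMinAt (L : ℕ) (hLo : Odd L) (hL1 : 1 < L) {a₀ a₁ B₃ : ℝ} (ha₀ : 0 < a₀) (ha₁ : 0 < a₁) (hB₃ : 0 < B₃)
    (hfloor : 2 * B₃ < (L : ℝ) * Real.sqrt L) (hT : Thm1GlobalMinAt L a₀ a₁ B₃)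
    (hposL : ∀ (m : ℕ), 0 < m → ∀ (b₀ p₀ : ℝ), 0 < b₀ → 2 < p₀ → ∃ γp : ℝ, 0 < γp ∧ ∀ (F : T3Family) (γ : ℝ), F.L = L → 0 < γ → γ ≤ γp →
      ∀ K, ∃ᵐ V ∂fieldMeasure (F.P (K / m)) 0 (Matrix.specialUnitaryGroup (Fin 2) ℂ),
      PlaqSmall (θBal F.L γ b₀ p₀ (K / m)) V ∧
        0 < heightDensity F γ (Nat.div_le_self K m) (histGood F ℰp (θBal F.L γ b₀ p₀) K (K / m)) V ∧
        0 < heightDensity F γ ((Nat.div_le_self K m).trans (Nat.le_succ K)) (histGood F ℰp (θBal F.L γ b₀ p₀) (K + 1) (K / m)) V) :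
    ∃ μ : ℝ, 0 < μ ∧ μ < 1 ∧ ∃ (b₁ p₁ : ℝ), ∀ (b₀ p₀ : ℝ), b₁ ≤ b₀ → p₁ ≤ p₀ → 0 < b₀ → 2 < p₀ →
      ∃ ε₁ : ℝ, 0 < ε₁ ∧ ∀ (ε₀ : ℝ), 0 < ε₀ → ε₀ ≤ ε₁ → ∃ m₀ : ℕ, ∀ (m : ℕ), m₀ ≤ m →
        ∃ γ₁ : ℝ, 0 < γ₁ ∧ ∀ (F : T3Family) (γ : ℝ), F.L = L → 0 < γ → γ ≤ γ₁ →
          ∃ r' : ℕ → ℝ, Summable r' ∧ (∀ K, 0 ≤ r' K) ∧ ∀ K, ∃ c : ℝ,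
            (∀ᵐ V ∂fieldMeasure (F.P (K / m)) 0 (Matrix.specialUnitaryGroup (Fin 2) ℂ),
              PlaqSmall (θBal F.L γ b₀ p₀ (K / m)) V →
                ¬ (ChiGood F γ b₀ p₀ ε₀ μ (Nat.div_le_self K m) V ∧
                    ChiGood F γ b₀ p₀ ε₀ μ ((Nat.div_le_self K m).trans (Nat.le_succ K)) V) →
                0 < heightDensity F γ (Nat.div_le_self K m) (histGood F ℰp (θBal F.L γ b₀ p₀) K (K / m)) V →
                0 < heightDensity F γ ((Nat.div_le_self K m).trans (Nat.le_succ K))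
                      (histGood F ℰp (θBal F.L γ b₀ p₀) (K + 1) (K / m)) V →
                  |(Real.log (heightDensity F γ ((Nat.div_le_self K m).trans (Nat.le_succ K))
                        (histGood F ℰp (θBal F.L γ b₀ p₀) (K + 1) (K / m)) V) + bgRegPr' F γ m ε₀ K V) -
                    (Real.log (heightDensity F γ (Nat.div_le_self K m) (histGood F ℰp (θBal F.L γ b₀ p₀) K (K / m)) V) + bgRegPr F γ m ε₀ K V) -
                      c| ≤ r' K) ∧
            (∃ᵐ V ∂fieldMeasure (F.P (K / m)) 0 (Matrix.specialUnitaryGroup (Fin 2) ℂ),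
              (PlaqSmall (θBal F.L γ b₀ p₀ (K / m)) V ∧
                ChiGood F γ b₀ p₀ ε₀ μ (Nat.div_le_self K m) V ∧
                ChiGood F γ b₀ p₀ ε₀ μ ((Nat.div_le_self K m).trans (Nat.le_succ K)) V) ∧
                0 < heightDensity F γ (Nat.div_le_self K m) (histGood F ℰp (θBal F.L γ b₀ p₀) K (K / m)) V ∧
                0 < heightDensity F γ ((Nat.div_le_self K m).trans (Nat.le_succ K))
                      (histGood F ℰp (θBal F.L γ b₀ p₀) (K + 1) (K / m)) V ∧
                  |(Real.log (heightDensity F γ ((Nat.div_le_self K m).trans (Nat.le_succ K))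
                        (histGood F ℰp (θBal F.L γ b₀ p₀) (K + 1) (K / m)) V) + bgRegPr' F γ m ε₀ K V) -
                    (Real.log (heightDensity F γ (Nat.div_le_self K m) (histGood F ℰp (θBal F.L γ b₀ p₀) K (K / m)) V) + bgRegPr F γ m ε₀ K V) -
                      c| ≤ r' K) := by
  have _ := hLo
  have hLr : (1 : ℝ) < L := by exact_mod_cast hL1
  have hL0 : (0 : ℝ) < L := by linarith
  have hLs : 0 < (L : ℝ) * Real.sqrt L := by positivity
  -- the margin `μ = (1 − 2B₃/(L√L))/2`
  set μ : ℝ := (1 - 2 * B₃ / ((L : ℝ) * Real.sqrt L)) / 2 with hμdef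
  have hq : 2 * B₃ / ((L : ℝ) * Real.sqrt L) < 1 := by rw [div_lt_one hLs]; exact hfloor
  have hq0 : 0 < 2 * B₃ / ((L : ℝ) * Real.sqrt L) := by positivity
  have hμ0 : 0 < μ := by rw [hμdef]; linarith
  have hμ1 : μ < 1 := by rw [hμdef]; linarith
  have hfl : 2 * B₃ ≤ (1 - μ) * ((L : ℝ) * Real.sqrt L) := by
    have e : (1 - μ) * ((L : ℝ) * Real.sqrt L) = ((L : ℝ) * Real.sqrt L + 2 * B₃) / 2 := by
      rw [hμdef]; field_simp; ring
    rw [e]; linarith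
  refine ⟨μ, hμ0, hμ1, 0, 0, fun b₀ p₀ _ _ hb hp => ⟨a₀, ha₀, fun ε₀ hε₀ hε₀a => ⟨2, fun m hm => ?_⟩⟩⟩
  have hm0 : 0 < m := by omega
  -- thresholds: one coupling bound makes every `θBal(n)` small enough for all five conditions
  have hC₀ : (0 : ℝ) < 143 * ((((3 + 4 : ℕ) : ℝ)) ^ 2 / 4) ^ 2 := by positivity
  have h7L : (0 : ℝ) < (((3 + 4) * L : ℕ) : ℝ) ^ 2 := by
    have : 0 < (3 + 4) * L := by omega
    positivity
  set t : ℝ := min (min a₁ (ε₀ / 5 / max B₃ 1)) (min (1 / 3 / (143 * ((((3 + 4 : ℕ) : ℝ)) ^ 2 / 4) ^ 2) / B₃)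
    (deltaSU (Fin 2) / (((3 + 4) * L : ℕ) : ℝ) ^ 2 / B₃)) with htdef
  have hB1 : 1 ≤ max B₃ 1 := le_max_right _ _
  have hBm : B₃ ≤ max B₃ 1 := le_max_left _ _
  have ht0 : 0 < t := by
    rw [htdef]
    refine lt_min (lt_min ha₁ (by positivity)) (lt_min (by positivity) (div_pos (div_pos deltaSU_pos h7L) hB₃))
  obtain ⟨γθ, hγθ, hθ⟩ := exists_forall_θBal_le hL1.le b₀ p₀ ht0
  obtain ⟨γp, hγp, hposF⟩ := hposL m hm0 b₀ p₀ hb hp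
  refine ⟨min (min γθ γp) 1, lt_min (lt_min hγθ hγp) one_pos, fun F γ hF hγ hγle => ?_⟩
  subst hF
  have hγθ' : γ ≤ γθ := hγle.trans ((min_le_left _ _).trans (min_le_left _ _))
  have hγp' : γ ≤ γp := hγle.trans ((min_le_left _ _).trans (min_le_right _ _))
  have hγ1 : γ ≤ 1 := hγle.trans (min_le_right _ _)
  have hθt : ∀ n, θBal F.L γ b₀ p₀ n ≤ t := hθ γ hγ hγθ'
  have hθ0 : ∀ n, 0 < θBal F.L γ b₀ p₀ n := fun n => T3MinimiserStabilityReduction.θBal_pos F.hL.2.le hγ hγ1 hb p₀ n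
  -- unpack the five consequences of `θ ≤ t`
  have hta₁ : t ≤ a₁ := (min_le_left _ _).trans (min_le_left _ _)
  have htε : t ≤ ε₀ / 5 / max B₃ 1 := (min_le_left _ _).trans (min_le_right _ _)
  have htC : t ≤ 1 / 3 / (143 * ((((3 + 4 : ℕ) : ℝ)) ^ 2 / 4) ^ 2) / B₃ := (min_le_right _ _).trans (min_le_left _ _)
  have htδ : t ≤ deltaSU (Fin 2) / (((3 + 4) * F.L : ℕ) : ℝ) ^ 2 / B₃ := (min_le_right _ _).trans (min_le_right _ _)
  have hthr : ∀ n, θBal F.L γ b₀ p₀ n ≤ a₁ ∧ B₃ * θBal F.L γ b₀ p₀ n ≤ ε₀ ∧ 4 * θBal F.L γ b₀ p₀ n < ε₀ := fun n => by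
    have h1 := (hθt n).trans htε
    have h2 : θBal F.L γ b₀ p₀ n * max B₃ 1 ≤ ε₀ / 5 := by rwa [le_div_iff₀ (lt_of_lt_of_le one_pos hB1)] at h1
    have h3 : B₃ * θBal F.L γ b₀ p₀ n ≤ θBal F.L γ b₀ p₀ n * max B₃ 1 := by
      rw [mul_comm]; exact mul_le_mul_of_nonneg_left hBm (hθ0 n).le
    have h4 : θBal F.L γ b₀ p₀ n ≤ θBal F.L γ b₀ p₀ n * max B₃ 1 := le_mul_of_one_le_right (hθ0 n).le hB1
    refine ⟨(hθt n).trans hta₁, by linarith, by linarith⟩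
  have hsm : ∀ n, (143 * ((((3 + 4 : ℕ) : ℝ)) ^ 2 / 4) ^ 2) * (B₃ * θBal F.L γ b₀ p₀ n) ≤ 1 / 3 ∧
      2 * (B₃ * θBal F.L γ b₀ p₀ n) ≤ 2 * deltaSU (Fin 2) / (((3 + 4) * F.L : ℕ) : ℝ) ^ 2 := fun n => by
    have h1 := (hθt n).trans htC
    have h2 := (hθt n).trans htδ
    rw [le_div_iff₀ hB₃] at h1 h2
    rw [le_div_iff₀ hC₀] at h1
    constructor
    · nlinarith [h1]
    · have : B₃ * θBal F.L γ b₀ p₀ n ≤ deltaSU (Fin 2) / (((3 + 4) * F.L : ℕ) : ℝ) ^ 2 := by rw [mul_comm]; exact h2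
      rw [mul_div_assoc]
      linarith
  exact edgeOffChi_of_thm1GlobalMinAt F hγ hγ1 hb (by linarith) hμ1 hB₃ hT hm hε₀a hthr hsm hfl (hposF F γ rfl hγ hγp')

end Summit.QuantumFields.YangMills.Theorems.PrintChi

end
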